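import Summits.QuantumFields.GaugeBoot.StrongCouplingPlaquetteSU3Third
import Summits.QuantumFields.GaugeBoot.StrongCouplingPlaquetteDLRWindow
import HarnessLib

/-!
# Strong coupling from the loop equation, VI′: the third-order `SU(3)` plaquette at every infinite-volume limit point and DLR state (gauge-boot, ADDENDUM 24 part H)

HONEST FRAMING (cell `pub-gaugeboot`, page 1 of every file): the venture produces certified bounds
on lattice expectations at stated coupling, gauge group, dimension and torus size; NOT a mass gap,
NOT a continuum limit, NOT a string tension; NOT Yang–Mills-summit-bearing (barriers
`FixedCouplingUltralocality`, `PerturbativeInvisibility`).  Analytic STRONG-COUPLING bounds, uniform in the volume, hence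
valid at every thermodynamic limit point; informative only for small `β_std`; no number of CERTIFIED.md is touched.

## Content (`SU(3)`, fundamental representation, `D ≥ 2`, standard coupling `β_std`, tree coupling `β_std/3`)

The torus bound `|plaquetteExpectation 3 D L β_std − β_std/18 − β_std²/216| ≤ D²(D−1)|β_std|³/8` of
`StrongCouplingPlaquetteSU3Third` holds for EVERY torus side `L ≥ 2`, so it passes (transfer lemma of
`StrongCouplingPlaquetteLimit`) to every weak limit point of the torus Wilson states, and — in the tree's Dobrushin window
`6(D−1)|β_std| < 1`, where every DLR state is such a limit point — to every DLR state:

* ★★★ `abs_integral_plaquette_su3_third_le_of_mem_limitPoints` — for every `μ ∈ infiniteVolumeLimitPoints (suRep 3) (β_std/3)`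
  and every plaquette of `ℤ^D`: `|∫ ⅓Re tr U_P dμ − β_std/18 − β_std²/216| ≤ D²(D−1)|β_std|³/8`; `D = 4`: `≤ 6|β_std|³`;
* ★★★ `abs_integral_plaquette_su3_third_le_of_mem_ymGibbsMeasures` — the same for every `μ ∈ 𝒢(β_std/3)` when
  `6(D−1)|β_std| < 1` (`D = 4`: `|β_std| < 1/18`, the whole informative range of the bound);
* ★★ `plaquetteWindow_su3_third` — the cell's TARGET SHAPE (A) at strong coupling through third order:
  `PlaquetteWindow 3 D L₀ β (β/18 + β²/216 − D²(D−1)|β|³/8) (β/18 + β²/216 + D²(D−1)|β|³/8)` for every `L₀ ≥ 2`, every real `β`.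

References: R. Balian, J.-M. Drouffe, C. Itzykson, Phys. Rev. D 11 (1975) 2104; K. Osterwalder, E. Seiler, Ann. Phys. 110 (1978)
440 (strong-coupling cluster expansion).  Everything is `[folklore]`.
-/

noncomputable section

open MeasureTheory Filter Topology
open Literature.MathematicalPhysics.QuantumFieldTheory
open Literature.MathematicalPhysics.QuantumLattice (LGConfig plaquetteObs infiniteVolumeLimitPoints ymGibbsMeasures)

namespace Summit.QuantumFields.GaugeBoot

namespace StrongCoupling

/-- ★★★ **Third order at every infinite-volume limit point, `SU(3)`**: for `D ≥ 2`, every real `β_std`, every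
`μ ∈ infiniteVolumeLimitPoints (suRep 3) (β_std/3)` and every plaquette of `ℤ^D`,
`|∫ ⅓Re tr U_P dμ − β_std/18 − β_std²/216| ≤ D²(D−1)|β_std|³/8`. [folklore] -/
theorem abs_integral_plaquette_su3_third_le_of_mem_limitPoints {D : ℕ} (hD : 2 ≤ D) (β : ℝ)
    {μ : Measure (LGConfig D (SU 3))} (hμ : μ ∈ infiniteVolumeLimitPoints (d := D) (suRep 3) (β / 3))
    (x : Literature.Probability.LatticeModels.Site D) {i j : Fin D} (hij : i ≠ j) :
    |∫ U, (3 : ℝ)⁻¹ * plaquetteObs (suRep 3) x i j U ∂μ - β / 18 - β ^ 2 / 216| ≤ (D : ℝ) ^ 2 * ((D : ℝ) - 1) * |β| ^ 3 / 8 := by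
  have h := abs_integral_plaquette_sub_le_of_forall (N := 3) (D := D) (c := β / 18 + β ^ 2 / 216)
    (K := (D : ℝ) ^ 2 * ((D : ℝ) - 1) * |β| ^ 3 / 8) (by norm_num)
    (fun L _ hL => by rw [← sub_sub]; exact abs_plaquetteExpectation_su3_third_le hL hD β) (by simpa using hμ) x hij
  rw [← sub_sub] at h
  simpa using h

/-- `SU(3)`, `D = 4`, at every infinite-volume limit point: `|∫ ⅓Re tr U_P dμ − β_std/18 − β_std²/216| ≤ 6|β_std|³`. [folklore] -/
theorem abs_integral_plaquette_su3_third_le_of_mem_limitPoints_four (β : ℝ) {μ : Measure (LGConfig 4 (SU 3))}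
    (hμ : μ ∈ infiniteVolumeLimitPoints (d := 4) (suRep 3) (β / 3)) (x : Literature.Probability.LatticeModels.Site 4)
    {i j : Fin 4} (hij : i ≠ j) :
    |∫ U, (3 : ℝ)⁻¹ * plaquetteObs (suRep 3) x i j U ∂μ - β / 18 - β ^ 2 / 216| ≤ 6 * |β| ^ 3 := by
  have h := abs_integral_plaquette_su3_third_le_of_mem_limitPoints (D := 4) (by norm_num) β hμ x hij
  norm_num at h
  linarith

/-- ★★★ **Third order for every DLR state in the uniqueness window, `SU(3)`**: for `D ≥ 2`, `6(D−1)|β_std| < 1`, every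
`μ ∈ 𝒢(β_std/3)` on `ℤ^D` and every plaquette: `|∫ ⅓Re tr U_P dμ − β_std/18 − β_std²/216| ≤ D²(D−1)|β_std|³/8`. [folklore] -/
theorem abs_integral_plaquette_su3_third_le_of_mem_ymGibbsMeasures {D : ℕ} (hD : 2 ≤ D) {β : ℝ}
    (hβ : 6 * ((D : ℝ) - 1) * |β| < 1) {μ : Measure (LGConfig D (SU 3))} (hμ : μ ∈ ymGibbsMeasures (d := D) (suRep 3) (β / 3))
    (x : Literature.Probability.LatticeModels.Site D) {i j : Fin D} (hij : i ≠ j) :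
    |∫ U, (3 : ℝ)⁻¹ * plaquetteObs (suRep 3) x i j U ∂μ - β / 18 - β ^ 2 / 216| ≤ (D : ℝ) ^ 2 * ((D : ℝ) - 1) * |β| ^ 3 / 8 :=
  abs_integral_plaquette_su3_third_le_of_mem_limitPoints hD β
    (by simpa using mem_limitPoints_of_mem_ymGibbsMeasures_of_small (N := 3) (D := D) (by norm_num) (by omega) hβ hμ) x hij

/-- `SU(3)`, `D = 4`, `|β_std| < 1/18`, every DLR state: `|∫ ⅓Re tr U_P dμ − β_std/18 − β_std²/216| ≤ 6|β_std|³`. [folklore] -/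
theorem abs_integral_plaquette_su3_third_le_of_mem_ymGibbsMeasures_four {β : ℝ} (hβ : 18 * |β| < 1)
    {μ : Measure (LGConfig 4 (SU 3))} (hμ : μ ∈ ymGibbsMeasures (d := 4) (suRep 3) (β / 3))
    (x : Literature.Probability.LatticeModels.Site 4) {i j : Fin 4} (hij : i ≠ j) :
    |∫ U, (3 : ℝ)⁻¹ * plaquetteObs (suRep 3) x i j U ∂μ - β / 18 - β ^ 2 / 216| ≤ 6 * |β| ^ 3 :=
  abs_integral_plaquette_su3_third_le_of_mem_limitPoints_four β
    (by simpa using mem_limitPoints_of_mem_ymGibbsMeasures_of_small (N := 3) (D := 4) (by norm_num) (by norm_num) (by norm_num; linarith) hμ) x hij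

/-! ## The cell's target shape (A) through third order -/

/-- ★★ **Analytic strong-coupling window through third order, shape (A), `SU(3)`**: for `D ≥ 2`, every `L₀ ≥ 2` and every
real `β_std`, `PlaquetteWindow 3 D L₀ β (β/18 + β²/216 − D²(D−1)|β|³/8) (β/18 + β²/216 + D²(D−1)|β|³/8)`. [folklore] -/
theorem plaquetteWindow_su3_third {D L₀ : ℕ} (hD : 2 ≤ D) (hL₀ : 2 ≤ L₀) (β : ℝ) :
    PlaquetteWindow 3 D L₀ β (β / 18 + β ^ 2 / 216 - (D : ℝ) ^ 2 * ((D : ℝ) - 1) * |β| ^ 3 / 8)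
      (β / 18 + β ^ 2 / 216 + (D : ℝ) ^ 2 * ((D : ℝ) - 1) * |β| ^ 3 / 8) := by
  intro L _ _ hL
  have h := abs_plaquetteExpectation_su3_third_le (D := D) (L := L) (hL₀.trans hL) hD β
  rw [abs_sub_le_iff] at h
  constructor <;> linarith [h.1, h.2]

/-- `T4` (`SU(3)`, `D = 4`), shape (A): `PlaquetteWindow 3 4 L₀ β (β/18 + β²/216 − 6|β|³) (β/18 + β²/216 + 6|β|³)` for every
`L₀ ≥ 2` and every real `β` — e.g. `β_std = 1/100`: `⟨ū_P⟩ ∈ [1/1800 + 1/2160000 − 6·10⁻⁶, 1/1800 + 1/2160000 + 6·10⁻⁶]` on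
every torus. [folklore] -/
theorem plaquetteWindow_su3_third_four {L₀ : ℕ} (hL₀ : 2 ≤ L₀) (β : ℝ) :
    PlaquetteWindow 3 4 L₀ β (β / 18 + β ^ 2 / 216 - 6 * |β| ^ 3) (β / 18 + β ^ 2 / 216 + 6 * |β| ^ 3) := by
  intro L _ _ hL
  have h := abs_plaquetteExpectation_three_four_third_le (L := L) (hL₀.trans hL) β
  rw [abs_sub_le_iff] at h
  constructor <;> linarith [h.1, h.2]

end StrongCoupling

end Summit.QuantumFields.GaugeBoot

end
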